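import Literature.Topology.FourManifolds.WrinklingMoveModel
import HarnessLib

/-!
# The triple cuspoid: the base diagram of Lekili's wrinkling move has exactly three cusps

Topic `Literature/Topology/FourManifolds`.  For the wrinkling family
`F_s(t, x, y, z) = (t² - x² + y² - z² + s t, 2 t x + 2 y z)` (`wrinklingMap s`,
`WrinklingMoveModel.lean`) the critical set is the circle `2(t² + x²) + s t = 0`, `y = z = 0`.
Lekili 2009, §3, Move 4: *"This circle can be parametrized by `t = -s/4 (1 + cos θ)`,
`x = s/4 sin θ`, and the critical value set is given by
`{(-s²/8 (1+cos θ)(2-cos θ), -s²/8 (1+cos θ) sin θ) : θ ∈ [0, 2π]}`. It is easily checked that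
this equation defines a curve with 3 cusps … We will refer to the critical value set of this
map as triple cuspoid"* (the move `W` of Baykur–Saeki 2017, §3.1, Fig. 6).  This file PROVES
the quoted parametrisation, the formula for the critical values, and the "easily checked"
claim: the velocity of the critical-value curve is `-(s²/8)(2 cos θ - 1) · (sin θ, cos θ + 1)`,
which for `s ≠ 0` vanishes exactly when `cos θ = 1/2` or `cos θ = -1` — three points of the
circle (`θ ≡ ±π/3, π`).  No named fact is introduced.

* `wrinkleCircle s θ`, `not_surjective_fderiv_wrinklingMap_wrinkleCircle`,
  `exists_wrinkleCircle_of_not_surjective` — the angle parametrisation IS the critical circle;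
* `wrinklingMap_wrinkleCircle` — the critical values `-(s²/8)((1+cos θ)(2-cos θ), (1+cos θ) sin θ)`;
* `hasDerivAt_wrinkle_image`, `wrinkle_image_deriv_eq_zero_iff` (`↔ cos θ = 1/2 ∨ cos θ = -1`),
  `wrinkleCircle_eq_zero_of_cos_eq_neg_one`, `sin_eq_or_of_cos_eq_half` — the three cusps.

## References

* Y. Lekili, *Wrinkled fibrations on near-symplectic manifolds*, Geom. Topol. 13 (2009)
  277–318 (arXiv:0712.2202), §3, Move 4. [Lekili2009]
* R. İ. Baykur, O. Saeki, *Simplifying indefinite fibrations on 4-manifolds*, arXiv:1705.11169,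
  §3.1 (move `W`), Fig. 6. [BaykurSaeki2017]
-/

noncomputable section

open Set Function

namespace Literature.Topology.FourManifolds

/-- Local notation: `𝔼 n` is the model Euclidean space `EuclideanSpace ℝ (Fin n)`. -/
local notation "𝔼 " n:arg => EuclideanSpace ℝ (Fin n)

/-! ### The critical circle, parametrised by the angle -/

/-- Lekili's parametrisation `θ ↦ (-s/4 (1 + cos θ), s/4 sin θ, 0, 0)` of the critical circle
of the wrinkling family. [cite: Lekili2009, §3 Move 4] -/
def wrinkleCircle (s θ : ℝ) : 𝔼 4 :=
  WithLp.toLp 2 ![-(s / 4) * (1 + Real.cos θ), s / 4 * Real.sin θ, 0, 0]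

/-- Coordinates of `wrinkleCircle`: `t = -s/4 (1 + cos θ)`. [folklore] -/
@[simp] theorem wrinkleCircle_apply_zero (s θ : ℝ) :
    wrinkleCircle s θ 0 = -(s / 4) * (1 + Real.cos θ) := by
  simp [wrinkleCircle]

/-- Coordinates of `wrinkleCircle`: `x = s/4 sin θ`. [folklore] -/
@[simp] theorem wrinkleCircle_apply_one (s θ : ℝ) : wrinkleCircle s θ 1 = s / 4 * Real.sin θ := by
  simp [wrinkleCircle]

/-- Coordinates of `wrinkleCircle`: `y = 0`. [folklore] -/
@[simp] theorem wrinkleCircle_apply_two (s θ : ℝ) : wrinkleCircle s θ 2 = 0 := by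
  simp [wrinkleCircle]

/-- Coordinates of `wrinkleCircle`: `z = 0`. [folklore] -/
@[simp] theorem wrinkleCircle_apply_three (s θ : ℝ) : wrinkleCircle s θ 3 = 0 := by
  simp [wrinkleCircle]

/-- **Every point of Lekili's parametrisation is critical**: `2(t² + x²) + s t = 0` there.
[cite: Lekili2009, §3 Move 4] -/
theorem not_surjective_fderiv_wrinklingMap_wrinkleCircle (s θ : ℝ) :
    ¬ Surjective (fderiv ℝ (wrinklingMap s) (wrinkleCircle s θ)) := by
  rw [surjective_fderiv_wrinklingMap_iff, not_not]
  refine ⟨by simp, by simp, ?_⟩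
  simp only [wrinkleCircle_apply_zero, wrinkleCircle_apply_one]
  linear_combination (s ^ 2 / 8) * Real.sin_sq_add_cos_sq θ

/-- **The parametrisation exhausts the critical circle** (`s ≠ 0`): every critical point of
`F_s` is `wrinkleCircle s θ` for some `θ` (write `(-(t + s/4) + i x)/(s/4) = e^{iθ}`).
[cite: Lekili2009, §3 Move 4] -/
theorem exists_wrinkleCircle_of_not_surjective {s : ℝ} (hs : s ≠ 0) {x : 𝔼 4}
    (hx : ¬ Surjective (fderiv ℝ (wrinklingMap s) x)) : ∃ θ, x = wrinkleCircle s θ := by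
  rw [not_surjective_fderiv_wrinklingMap_iff] at hx
  obtain ⟨h2, h3, hcirc⟩ := hx
  have hs4 : s / 4 ≠ 0 := by positivity
  set z : ℂ := ⟨-(x 0 + s / 4) / (s / 4), x 1 / (s / 4)⟩ with hz_def
  have hz2 : ‖z‖ ^ 2 = 1 := by
    rw [Complex.sq_norm, Complex.normSq_apply]
    simp only [hz_def]
    field_simp
    nlinarith [hcirc]
  have hz1 : ‖z‖ = 1 := (pow_eq_one_iff_of_nonneg (norm_nonneg z) two_ne_zero).mp hz2
  obtain ⟨θ, hθ⟩ := (Complex.norm_eq_one_iff z).mp hz1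
  refine ⟨θ, ?_⟩
  have hre : Real.cos θ = -(x 0 + s / 4) / (s / 4) := by
    rw [← Complex.exp_ofReal_mul_I_re θ, hθ]
  have him : Real.sin θ = x 1 / (s / 4) := by
    rw [← Complex.exp_ofReal_mul_I_im θ, hθ]
  have hx0 : x 0 = -(s / 4) * (1 + -(x 0 + s / 4) / (s / 4)) := by
    field_simp
    ring
  have hx1 : x 1 = s / 4 * (x 1 / (s / 4)) := by
    field_simp
  ext i
  fin_cases i
  · simpa [hre] using hx0
  · simpa [him] using hx1
  · simpa using h2
  · simpa using h3

/-! ### The critical values and the three cusps -/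

/-- **The critical values of the wrinkle** (Lekili 2009, §3, Move 4):
`F_s(wrinkleCircle s θ) = -(s²/8) ((1 + cos θ)(2 - cos θ), (1 + cos θ) sin θ)`.
[cite: Lekili2009, §3 Move 4] -/
theorem wrinklingMap_wrinkleCircle (s θ : ℝ) :
    wrinklingMap s (wrinkleCircle s θ) =
      (-(s ^ 2 / 8) * ((1 + Real.cos θ) * (2 - Real.cos θ))) • EuclideanSpace.single (0 : Fin 2) (1 : ℝ) +
        (-(s ^ 2 / 8) * ((1 + Real.cos θ) * Real.sin θ)) •
          EuclideanSpace.single (1 : Fin 2) (1 : ℝ) := by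
  ext i
  fin_cases i
  · simp
    linear_combination (-(s ^ 2 / 16)) * Real.sin_sq θ
  · simp
    ring

/-- **Velocity of the critical-value curve of the wrinkle**:
`-(s²/8)(2 cos θ - 1) · (sin θ, cos θ + 1)` (derivatives of `(1 + cos θ)(2 - cos θ)` and
`(1 + cos θ) sin θ`, using `sin² θ + cos² θ = 1`). [folklore] -/
theorem hasDerivAt_wrinkle_image (s θ : ℝ) :
    HasDerivAt (fun θ => wrinklingMap s (wrinkleCircle s θ))
      ((-(s ^ 2 / 8) * (Real.sin θ * (2 * Real.cos θ - 1))) •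
          EuclideanSpace.single (0 : Fin 2) (1 : ℝ) +
        (-(s ^ 2 / 8) * ((2 * Real.cos θ - 1) * (Real.cos θ + 1))) •
          EuclideanSpace.single (1 : Fin 2) (1 : ℝ)) θ := by
  have hc : HasDerivAt (fun θ => 1 + Real.cos θ) (-Real.sin θ) θ := by
    simpa using (Real.hasDerivAt_cos θ).const_add 1
  have hd : HasDerivAt (fun θ => 2 - Real.cos θ) (Real.sin θ) θ := by
    simpa using (Real.hasDerivAt_cos θ).const_sub 2
  have h1 : HasDerivAt (fun θ => -(s ^ 2 / 8) * ((1 + Real.cos θ) * (2 - Real.cos θ)))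
      (-(s ^ 2 / 8) * (-Real.sin θ * (2 - Real.cos θ) + (1 + Real.cos θ) * Real.sin θ)) θ :=
    (hc.mul hd).const_mul _
  have h2 : HasDerivAt (fun θ => -(s ^ 2 / 8) * ((1 + Real.cos θ) * Real.sin θ))
      (-(s ^ 2 / 8) * (-Real.sin θ * Real.sin θ + (1 + Real.cos θ) * Real.cos θ)) θ :=
    (hc.mul (Real.hasDerivAt_sin θ)).const_mul _
  have h := (h1.smul_const (EuclideanSpace.single (0 : Fin 2) (1 : ℝ))).add
    (h2.smul_const (EuclideanSpace.single (1 : Fin 2) (1 : ℝ)))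
  have hfun : (fun θ => wrinklingMap s (wrinkleCircle s θ)) = fun θ =>
      (-(s ^ 2 / 8) * ((1 + Real.cos θ) * (2 - Real.cos θ))) •
          EuclideanSpace.single (0 : Fin 2) (1 : ℝ) +
        (-(s ^ 2 / 8) * ((1 + Real.cos θ) * Real.sin θ)) •
          EuclideanSpace.single (1 : Fin 2) (1 : ℝ) :=
    funext (wrinklingMap_wrinkleCircle s)
  rw [hfun]
  refine h.congr_deriv ?_
  congr 1
  · congr 1
    ring
  · congr 1
    linear_combination (s ^ 2 / 8) * Real.sin_sq_add_cos_sq θ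

/-- **The triple cuspoid has its cusps exactly where `cos θ = 1/2` or `cos θ = -1`**
(`s ≠ 0`): the velocity of the critical-value curve vanishes iff `2 cos θ - 1 = 0`, or
`sin θ = 0 = cos θ + 1`; on the circle these are the three points `θ ≡ π/3, -π/3, π` —
Lekili's *"curve with 3 cusps"*. [cite: Lekili2009, §3 Move 4] -/
theorem wrinkle_image_deriv_eq_zero_iff {s : ℝ} (hs : s ≠ 0) (θ : ℝ) :
    deriv (fun θ => wrinklingMap s (wrinkleCircle s θ)) θ = 0 ↔
      Real.cos θ = 1 / 2 ∨ Real.cos θ = -1 := by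
  rw [(hasDerivAt_wrinkle_image s θ).deriv]
  have hs8 : -(s ^ 2 / 8) ≠ 0 := by
    have : 0 < s ^ 2 := by positivity
    linarith
  constructor
  · intro h
    have h0 := congrArg (fun w : 𝔼 2 => w 0) h
    have h1 := congrArg (fun w : 𝔼 2 => w 1) h
    simp only [PiLp.add_apply, PiLp.smul_apply, smul_eq_mul, PiLp.zero_apply] at h0 h1
    simp at h0 h1
    rcases h1 with h1 | h1 | h1
    · exact absurd (by linarith : s = 0) hs
    · left
      linarith
    · right
      linarith
  · rintro (hc | hc)
    · have h21 : 2 * Real.cos θ - 1 = 0 := by rw [hc]; ring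
      simp [h21]
    · have hsin : Real.sin θ = 0 := by
        have := Real.sin_sq_add_cos_sq θ
        rw [hc] at this
        nlinarith [sq_nonneg (Real.sin θ)]
      have hc1 : Real.cos θ + 1 = 0 := by rw [hc]; ring
      simp [hsin, hc1]

/-- **The cusp at `cos θ = -1` is the Lefschetz point itself**: there `wrinkleCircle s θ = 0`
(the origin lies on the critical circle for every `s`). [folklore] -/
theorem wrinkleCircle_eq_zero_of_cos_eq_neg_one {s θ : ℝ} (hc : Real.cos θ = -1) :
    wrinkleCircle s θ = 0 := by
  have hsin : Real.sin θ = 0 := by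
    have := Real.sin_sq_add_cos_sq θ
    rw [hc] at this
    nlinarith [sq_nonneg (Real.sin θ)]
  ext i
  fin_cases i <;> simp [hc, hsin]

/-- At the two other cusps `cos θ = 1/2`, so `sin θ = ±√3/2`: the critical points
`(-3s/8, ±(√3/8) s, 0, 0)`. [folklore] -/
theorem sin_eq_or_of_cos_eq_half {θ : ℝ} (hc : Real.cos θ = 1 / 2) :
    Real.sin θ = Real.sqrt 3 / 2 ∨ Real.sin θ = -(Real.sqrt 3 / 2) := by
  have h3 : Real.sqrt 3 ^ 2 = 3 := Real.sq_sqrt (by norm_num)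
  have hsq : Real.sin θ ^ 2 = (Real.sqrt 3 / 2) ^ 2 := by
    have := Real.sin_sq_add_cos_sq θ
    rw [hc] at this
    nlinarith [h3]
  exact sq_eq_sq_iff_eq_or_eq_neg.mp hsq

/-- The two cusps with `cos θ = 1/2` as points of `ℝ⁴`: `(-3s/8, ±(√3/8) s, 0, 0)`. [folklore] -/
theorem wrinkleCircle_eq_of_cos_eq_half {s θ : ℝ} (hc : Real.cos θ = 1 / 2) :
    wrinkleCircle s θ = WithLp.toLp 2 ![-(3 * s / 8), Real.sqrt 3 / 8 * s, 0, 0] ∨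
      wrinkleCircle s θ = WithLp.toLp 2 ![-(3 * s / 8), -(Real.sqrt 3 / 8 * s), 0, 0] := by
  rcases sin_eq_or_of_cos_eq_half hc with hsn | hsn
  · left
    ext i
    fin_cases i <;> simp [hc, hsn] <;> ring
  · right
    ext i
    fin_cases i <;> simp [hc, hsn] <;> ring

end Literature.Topology.FourManifolds

end
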